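/-
Copyright: the m5 harness (cell B2b-5 `b2b-lgcu-borel`, generation 21).  Sorry-free; axioms: propext,
Classical.choice, Quot.sound.  VALUE = THEOREM (a budget-free, TPP-free exclusion on the level-one
slice), NOT summit progress: the crux `SubgroupIdentityDesigns` is untouched.
-/
import Mathlib
import Literature.NumberTheory.GaloisRepresentations.ArtinReciprocityCyclic
import Summits.MatrixMultiplication.MatrixMultiplication.Theorems.SubgroupIdentityDesigns.Negative.AdmissibilityPrinciple

/-!
# No member of a level-one witness contains a homology pencil

The general form of the reflection-configuration exclusion of `AdmissibilityPrinciple`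
(`reflFamily_not_subset_member`), as an instance of its covering exclusion `false_of_cover`.

Fix a unit `d ∈ 𝔽_pˣ`, `d ≠ 1`, and two coordinates `i₀ ≠ i₁` of `𝔽_p^m`; let
`L = {v : v_{i₀} = v_{i₁} = 0}` (codimension 2).  The `p + 1` hyperplanes containing `L` are
`Π_t = {v_{i₀} = t v_{i₁}}` (`t ∈ 𝔽_p`) and `Π_∞ = {v_{i₁} = 0}`; together they cover `𝔽_p^m`.
A HOMOLOGY PENCIL with eigenvalue `d` over `L` in a subgroup `K ≤ GL_m(𝔽_p)` is a choice, for each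
of these `p + 1` hyperplanes `Π`, of an element `g_Π ∈ K` of determinant `d` fixing `Π` pointwise
(a homology with axis `Π`; for `d = −1` a reflection).

* `exists_unitChar_apply_ne_one` / `exists_unitChar_injective` — for `d ≠ 1` there is a character
  `χ` of `𝔽_pˣ` with `χ(d) ≠ 1`; there is a FAITHFUL `χ` (`𝔽_pˣ` is cyclic);
* `false_of_det_ne_one_cover`, `det_ne_one_cover_not_le_member` — SHARP FORM: if every vector is
  fixed by an element of `K` of determinant `≠ 1` (varying with the vector), then `K` carries no
  level-one delta and lies in no member (`σ = χ ∘ det`, `χ` faithful); `mixed_pencil_not_le_member`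
  — the pencil version with hyperplane-dependent eigenvalues;
* `exists_ne_zero_unimodular_stabilizer`, `member_exists_unimodular_stabilizer` — dually: a
  subgroup `K ⊄ SL_m(𝔽_p)` of a member has a NON-ZERO vector whose `K`-stabiliser lies in
  `SL_m(𝔽_p)` (the admissible vector of the faithful determinant character);
* `false_of_det_cover_of_ne_one` — if every vector is fixed by an element of `K` of determinant `d`,
  then `K` carries no level-one delta (`σ = χ ∘ det` is `≠ 1` on a stabiliser element of every
  vector: no `σ`-admissible vector, contradicting the admissibility principle);
* `cover_of_pencil` — a homology pencil over `L` fixes every vector by an element of determinant `d`;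
* `pencil_not_le_member` — **no member `H₁, H₂, H₃` of a subgroup-TPP triple carrying a level-one
  identity design contains a homology pencil**: every `p`, every `m ≥ 2`, every position, every
  exponent `ε`; neither the TPP nor the character budget is used.

Instances (paper level, `run/shared/lean/b2b/levelgraded-cu/ORACLE-g21.md` §G21-8/§G21-10; the
first is `AdmissibilityPrinciple.reflFamily_not_subset_member` in Lean): with `P = ⟨e_{i₀}, e_{i₁}⟩`
and everything `⊕ 1` on the other coordinates —
(1) the reflections `R_t = 1 − 2E_{i₀i₀} + 2tE_{i₀i₁}`, `R_∞ = 1 − 2E_{i₁i₁}` (group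
`{[[±1,*],[0,±1]]}`, order `4p`); (2) the `p + 1` reflections of an anisotropic orthogonal plane
`O₂⁻(𝔽_p)` (dihedral, order `2(p + 1)`); (3) the signed monomial pencil `antidiag(c, c⁻¹)`
(`c ∈ 𝔽_pˣ`), `diag(−1, 1)`, `diag(1, −1)` (order `4(p − 1)`); (4) for `3 ∣ p − 1`, pencils of
homologies of order `3`.  GAP catalogue (kit job, `code/g21/gap/carrier_scan.g`): in `GL₂(𝔽₅)` the
non-carrier classes inside the order window are exactly (2), (3), (1) (orders 12, 16, 20), all
minimal and all detected by a linear character.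
-/

noncomputable section

open scoped BigOperators Classical Matrix

namespace Summit.MatrixMultiplication.MatrixMultiplication.Theorems.SubgroupIdentityDesigns.Negative
namespace HomologyPencil

open Literature.Barriers.MatrixMultiplication (SubgroupTPP)
open Summit.MatrixMultiplication.MatrixMultiplication.Theorems.LieRankDesigns.Negative (GLm Mat)
open Summit.MatrixMultiplication.MatrixMultiplication.Theorems.LevelOneGL2Designs.Negative
open PackingBridge (exists_test)
open AdmissibilityPrinciple (false_of_cover vanish_of_le)

variable {p m : ℕ} [hp : Fact p.Prime]

/-- For a unit `d ≠ 1` of `𝔽_p` there is a character `χ : 𝔽_pˣ → ℂˣ` with `χ(d) ≠ 1` (duality of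
finite abelian groups; `ℂ` has enough roots of unity). -/
theorem exists_unitChar_apply_ne_one {d : (ZMod p)ˣ} (hd : d ≠ 1) :
    ∃ χ : (ZMod p)ˣ →* ℂˣ, χ d ≠ 1 := by
  haveI : NeZero ((Monoid.exponent (ZMod p)ˣ : ℕ) : ℂ) :=
    ⟨Nat.cast_ne_zero.2 Monoid.exponent_ne_zero_of_finite⟩
  exact CommGroup.exists_apply_ne_one_of_hasEnoughRootsOfUnity (ZMod p)ˣ ℂ hd

/-- **Determinant covering exclusion (general eigenvalue).**  If every vector of `𝔽_p^m` is fixed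
by an element of `K` of determinant `d ≠ 1`, then `K` carries no level-one delta. -/
theorem false_of_det_cover_of_ne_one {d : (ZMod p)ˣ} (hd : d ≠ 1) {K : Subgroup (GLm p m)}
    (hcov : ∀ u : Fin m → ZMod p, ∃ k : K, k • u = u ∧
      Matrix.GeneralLinearGroup.det (k : GLm p m) = d)
    {f : GLm p m → ℂ} (hf : f ∈ levelSubmodule p m 1) (h1 : f 1 = 1)
    (h0 : ∀ k : K, (k : GLm p m) ≠ 1 → f k = 0) : False := by
  obtain ⟨χ, hχ⟩ := exists_unitChar_apply_ne_one (p := p) hd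
  refine false_of_cover (σ := χ.comp (Matrix.GeneralLinearGroup.det.comp K.subtype))
    (fun u => ?_) hf h1 h0
  obtain ⟨k, hk, hdet⟩ := hcov u
  refine ⟨k, hk, ?_⟩
  show χ (Matrix.GeneralLinearGroup.det (k : GLm p m)) ≠ 1
  rw [hdet]
  exact hχ

/-- A FAITHFUL character of `𝔽_pˣ`: the unit group of `𝔽_p` is cyclic, and a finite cyclic group
embeds in `ℂˣ` (`Literature.NumberTheory.GaloisRepresentations.exists_monoidHom_units_complex_injective`). -/
theorem exists_unitChar_injective : ∃ χ : (ZMod p)ˣ →* ℂˣ, Function.Injective χ := by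
  haveI : IsCyclic (ZMod p)ˣ := ZMod.isCyclic_units_prime hp.out
  exact Literature.NumberTheory.GaloisRepresentations.exists_monoidHom_units_complex_injective _

/-- **Determinant covering exclusion (sharp form).**  If every vector of `𝔽_p^m` is fixed by an
element of `K` of determinant `≠ 1` (the determinants may vary with the vector), then `K` carries
no level-one delta: with `χ` faithful, `σ = χ ∘ det` is `≠ 1` on a stabiliser element of every
vector. -/
theorem false_of_det_ne_one_cover {K : Subgroup (GLm p m)}
    (hcov : ∀ u : Fin m → ZMod p, ∃ k : K, k • u = u ∧
      Matrix.GeneralLinearGroup.det (k : GLm p m) ≠ 1)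
    {f : GLm p m → ℂ} (hf : f ∈ levelSubmodule p m 1) (h1 : f 1 = 1)
    (h0 : ∀ k : K, (k : GLm p m) ≠ 1 → f k = 0) : False := by
  obtain ⟨χ, hχ⟩ := exists_unitChar_injective (p := p)
  refine false_of_cover (σ := χ.comp (Matrix.GeneralLinearGroup.det.comp K.subtype))
    (fun u => ?_) hf h1 h0
  obtain ⟨k, hk, hdet⟩ := hcov u
  refine ⟨k, hk, fun h => hdet (hχ ?_)⟩
  rw [map_one]
  exact h

/-- **No member contains a subgroup all of whose vectors are fixed by elements of determinant
`≠ 1`** (crux form, level `k = 1`; every `p`, `m`, position, exponent; no TPP). -/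
theorem det_ne_one_cover_not_le_member {K : Subgroup (GLm p m)}
    (hcov : ∀ u : Fin m → ZMod p, ∃ k : K, k • u = u ∧
      Matrix.GeneralLinearGroup.det (k : GLm p m) ≠ 1)
    {H₁ H₂ H₃ : Subgroup (GLm p m)}
    (hdes : ∃ c : Mat p m → ℂ, (∀ M, 1 < M.rank → c M = 0) ∧
      (∑ M, c M * ZMod.stdAddChar (Matrix.trace (M * ((1 : GLm p m) : Mat p m)))) = 1 ∧
      ∀ a ∈ H₁, ∀ b ∈ H₂, ∀ g ∈ H₃, a * b * g ≠ 1 →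
        (∑ M, c M * ZMod.stdAddChar (Matrix.trace (M * ((a * b * g : GLm p m) : Mat p m)))) = 0) :
    ¬K ≤ H₁ ∧ ¬K ≤ H₂ ∧ ¬K ≤ H₃ := by
  obtain ⟨f, hf, h1, h0⟩ := exists_test hdes
  exact ⟨fun h => false_of_det_ne_one_cover hcov hf h1 (vanish_of_le h0 (Or.inl h)),
    fun h => false_of_det_ne_one_cover hcov hf h1 (vanish_of_le h0 (Or.inr (Or.inl h))),
    fun h => false_of_det_ne_one_cover hcov hf h1 (vanish_of_le h0 (Or.inr (Or.inr h)))⟩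

/-- **UNIMODULAR STABILISERS.**  If `K` carries a level-one delta and is not contained in
`SL_m(𝔽_p)`, then some NON-ZERO vector has its whole `K`-stabiliser inside `SL_m(𝔽_p)`: apply the
admissibility principle to `σ = χ ∘ det` with `χ` faithful. -/
theorem exists_ne_zero_unimodular_stabilizer {K : Subgroup (GLm p m)}
    (hK : ∃ k ∈ K, Matrix.GeneralLinearGroup.det k ≠ 1)
    {f : GLm p m → ℂ} (hf : f ∈ levelSubmodule p m 1) (h1 : f 1 = 1)
    (h0 : ∀ k : K, (k : GLm p m) ≠ 1 → f k = 0) :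
    ∃ u : Fin m → ZMod p, u ≠ 0 ∧
      ∀ k ∈ K, k • u = u → Matrix.GeneralLinearGroup.det k = 1 := by
  obtain ⟨χ, hχ⟩ := exists_unitChar_injective (p := p)
  obtain ⟨k₀, hk₀, hdet₀⟩ := hK
  set σ : K →* ℂˣ := χ.comp (Matrix.GeneralLinearGroup.det.comp K.subtype) with hσdef
  have hσk₀ : σ ⟨k₀, hk₀⟩ ≠ 1 := fun h => hdet₀ (hχ (by rw [map_one]; exact h))
  have hσ : σ ≠ 1 := fun h => hσk₀ (by rw [h]; rfl)
  obtain ⟨u, hu⟩ := AdmissibilityPrinciple.exists_mem_adm hσ hf h1 h0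
  refine ⟨u, ?_, fun k hk hfix => hχ ?_⟩
  · rintro rfl
    exact hσk₀ (hu ⟨k₀, hk₀⟩ (smul_zero _))
  · rw [map_one]
    exact hu ⟨k, hk⟩ hfix

/-- **Members have unimodular stabilisers** (crux notation, level `k = 1`): every subgroup `K`
of a member of a triple carrying a level-one identity design, unless `K ≤ SL_m(𝔽_p)`, has a
non-zero vector whose `K`-stabiliser lies in `SL_m(𝔽_p)` — every `p`, `m`, position, exponent. -/
theorem member_exists_unimodular_stabilizer {K H₁ H₂ H₃ : Subgroup (GLm p m)}
    (hK : ∃ k ∈ K, Matrix.GeneralLinearGroup.det k ≠ 1) (hle : K ≤ H₁ ∨ K ≤ H₂ ∨ K ≤ H₃)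
    (hdes : ∃ c : Mat p m → ℂ, (∀ M, 1 < M.rank → c M = 0) ∧
      (∑ M, c M * ZMod.stdAddChar (Matrix.trace (M * ((1 : GLm p m) : Mat p m)))) = 1 ∧
      ∀ a ∈ H₁, ∀ b ∈ H₂, ∀ g ∈ H₃, a * b * g ≠ 1 →
        (∑ M, c M * ZMod.stdAddChar (Matrix.trace (M * ((a * b * g : GLm p m) : Mat p m)))) = 0) :
    ∃ u : Fin m → ZMod p, u ≠ 0 ∧
      ∀ k ∈ K, k • u = u → Matrix.GeneralLinearGroup.det k = 1 := by
  obtain ⟨f, hf, h1, h0⟩ := exists_test hdes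
  exact exists_ne_zero_unimodular_stabilizer hK hf h1 (vanish_of_le h0 hle)

section Pencil

variable {i₀ i₁ : Fin m}

/-- **Cover by a homology pencil.**  If `K` contains, for every `t ∈ 𝔽_p`, an element of
determinant `d` fixing the hyperplane `{v_{i₀} = t v_{i₁}}` pointwise, and one fixing
`{v_{i₁} = 0}` pointwise, then every vector is fixed by an element of `K` of determinant `d`. -/
theorem cover_of_pencil {d : (ZMod p)ˣ} {K : Subgroup (GLm p m)}
    (hK : ∀ t : ZMod p, ∃ g ∈ K, Matrix.GeneralLinearGroup.det g = d ∧
      ∀ v : Fin m → ZMod p, v i₀ = t * v i₁ → g • v = v)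
    (hK' : ∃ g ∈ K, Matrix.GeneralLinearGroup.det g = d ∧
      ∀ v : Fin m → ZMod p, v i₁ = 0 → g • v = v)
    (u : Fin m → ZMod p) :
    ∃ k : K, k • u = u ∧ Matrix.GeneralLinearGroup.det (k : GLm p m) = d := by
  by_cases hu : u i₁ = 0
  · obtain ⟨g, hg, hdet, hfix⟩ := hK'
    exact ⟨⟨g, hg⟩, hfix u hu, hdet⟩
  · obtain ⟨g, hg, hdet, hfix⟩ := hK (u i₀ * (u i₁)⁻¹)
    exact ⟨⟨g, hg⟩, hfix u (by rw [mul_assoc, inv_mul_cancel₀ hu, mul_one]), hdet⟩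

/-- **Cover by a mixed homology pencil** (eigenvalues may vary with the hyperplane). -/
theorem cover_of_mixed_pencil {K : Subgroup (GLm p m)}
    (hK : ∀ t : ZMod p, ∃ g ∈ K, Matrix.GeneralLinearGroup.det g ≠ 1 ∧
      ∀ v : Fin m → ZMod p, v i₀ = t * v i₁ → g • v = v)
    (hK' : ∃ g ∈ K, Matrix.GeneralLinearGroup.det g ≠ 1 ∧
      ∀ v : Fin m → ZMod p, v i₁ = 0 → g • v = v)
    (u : Fin m → ZMod p) :
    ∃ k : K, k • u = u ∧ Matrix.GeneralLinearGroup.det (k : GLm p m) ≠ 1 := by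
  by_cases hu : u i₁ = 0
  · obtain ⟨g, hg, hdet, hfix⟩ := hK'
    exact ⟨⟨g, hg⟩, hfix u hu, hdet⟩
  · obtain ⟨g, hg, hdet, hfix⟩ := hK (u i₀ * (u i₁)⁻¹)
    exact ⟨⟨g, hg⟩, hfix u (by rw [mul_assoc, inv_mul_cancel₀ hu, mul_one]), hdet⟩

/-- **No member contains a mixed homology pencil**: for each of the `p + 1` hyperplanes through
`{v_{i₀} = v_{i₁} = 0}` an element of `K` of determinant `≠ 1` fixing it pointwise. -/
theorem mixed_pencil_not_le_member {K : Subgroup (GLm p m)}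
    (hK : ∀ t : ZMod p, ∃ g ∈ K, Matrix.GeneralLinearGroup.det g ≠ 1 ∧
      ∀ v : Fin m → ZMod p, v i₀ = t * v i₁ → g • v = v)
    (hK' : ∃ g ∈ K, Matrix.GeneralLinearGroup.det g ≠ 1 ∧
      ∀ v : Fin m → ZMod p, v i₁ = 0 → g • v = v)
    {H₁ H₂ H₃ : Subgroup (GLm p m)}
    (hdes : ∃ c : Mat p m → ℂ, (∀ M, 1 < M.rank → c M = 0) ∧
      (∑ M, c M * ZMod.stdAddChar (Matrix.trace (M * ((1 : GLm p m) : Mat p m)))) = 1 ∧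
      ∀ a ∈ H₁, ∀ b ∈ H₂, ∀ g ∈ H₃, a * b * g ≠ 1 →
        (∑ M, c M * ZMod.stdAddChar (Matrix.trace (M * ((a * b * g : GLm p m) : Mat p m)))) = 0) :
    ¬K ≤ H₁ ∧ ¬K ≤ H₂ ∧ ¬K ≤ H₃ :=
  det_ne_one_cover_not_le_member (cover_of_mixed_pencil hK hK') hdes

/-- A homology pencil with eigenvalue `d ≠ 1` carries no level-one delta. -/
theorem false_of_pencil {d : (ZMod p)ˣ} (hd : d ≠ 1) {K : Subgroup (GLm p m)}
    (hK : ∀ t : ZMod p, ∃ g ∈ K, Matrix.GeneralLinearGroup.det g = d ∧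
      ∀ v : Fin m → ZMod p, v i₀ = t * v i₁ → g • v = v)
    (hK' : ∃ g ∈ K, Matrix.GeneralLinearGroup.det g = d ∧
      ∀ v : Fin m → ZMod p, v i₁ = 0 → g • v = v)
    {f : GLm p m → ℂ} (hf : f ∈ levelSubmodule p m 1) (h1 : f 1 = 1)
    (h0 : ∀ k : K, (k : GLm p m) ≠ 1 → f k = 0) : False :=
  false_of_det_cover_of_ne_one hd (cover_of_pencil hK hK') hf h1 h0

/-- **No member contains a homology pencil** (from a level-one identity test on the triple). -/
theorem pencil_not_le_member_of_test {d : (ZMod p)ˣ} (hd : d ≠ 1) {K : Subgroup (GLm p m)}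
    (hK : ∀ t : ZMod p, ∃ g ∈ K, Matrix.GeneralLinearGroup.det g = d ∧
      ∀ v : Fin m → ZMod p, v i₀ = t * v i₁ → g • v = v)
    (hK' : ∃ g ∈ K, Matrix.GeneralLinearGroup.det g = d ∧
      ∀ v : Fin m → ZMod p, v i₁ = 0 → g • v = v)
    {H₁ H₂ H₃ : Subgroup (GLm p m)} {f : GLm p m → ℂ}
    (hf : f ∈ levelSubmodule p m 1) (h1 : f 1 = 1)
    (h0 : ∀ a ∈ H₁, ∀ b ∈ H₂, ∀ c ∈ H₃, a * b * c ≠ 1 → f (a * b * c) = 0) :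
    ¬K ≤ H₁ ∧ ¬K ≤ H₂ ∧ ¬K ≤ H₃ :=
  ⟨fun h => false_of_pencil hd hK hK' hf h1 (vanish_of_le h0 (Or.inl h)),
    fun h => false_of_pencil hd hK hK' hf h1 (vanish_of_le h0 (Or.inr (Or.inl h))),
    fun h => false_of_pencil hd hK hK' hf h1 (vanish_of_le h0 (Or.inr (Or.inr h)))⟩

/-- **Crux form.**  In the notation of `SubgroupIdentityDesigns` at level `k = 1`: if
`(H₁, H₂, H₃)` carries a level-one identity design, then no member contains a subgroup `K` with a
homology pencil (eigenvalue `d ≠ 1`) over a coordinate codimension-`2` subspace — for every prime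
`p`, every `m`, every position and every exponent. -/
theorem pencil_not_le_member {d : (ZMod p)ˣ} (hd : d ≠ 1) {K : Subgroup (GLm p m)}
    (hK : ∀ t : ZMod p, ∃ g ∈ K, Matrix.GeneralLinearGroup.det g = d ∧
      ∀ v : Fin m → ZMod p, v i₀ = t * v i₁ → g • v = v)
    (hK' : ∃ g ∈ K, Matrix.GeneralLinearGroup.det g = d ∧
      ∀ v : Fin m → ZMod p, v i₁ = 0 → g • v = v)
    {H₁ H₂ H₃ : Subgroup (GLm p m)}
    (hdes : ∃ c : Mat p m → ℂ, (∀ M, 1 < M.rank → c M = 0) ∧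
      (∑ M, c M * ZMod.stdAddChar (Matrix.trace (M * ((1 : GLm p m) : Mat p m)))) = 1 ∧
      ∀ a ∈ H₁, ∀ b ∈ H₂, ∀ g ∈ H₃, a * b * g ≠ 1 →
        (∑ M, c M * ZMod.stdAddChar (Matrix.trace (M * ((a * b * g : GLm p m) : Mat p m)))) = 0) :
    ¬K ≤ H₁ ∧ ¬K ≤ H₂ ∧ ¬K ≤ H₃ := by
  obtain ⟨f, hf, h1, h0⟩ := exists_test hdes
  exact pencil_not_le_member_of_test hd hK hK' hf h1 h0

/-- Conjugates: the same for a pencil over ANY codimension-`2` subspace `x • L`, stated through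
the conjugating element (if `K` contains a pencil over `L`, no member contains `x K x⁻¹`). -/
theorem conj_pencil_not_le_member {d : (ZMod p)ˣ} (hd : d ≠ 1) {K : Subgroup (GLm p m)}
    (hK : ∀ t : ZMod p, ∃ g ∈ K, Matrix.GeneralLinearGroup.det g = d ∧
      ∀ v : Fin m → ZMod p, v i₀ = t * v i₁ → g • v = v)
    (hK' : ∃ g ∈ K, Matrix.GeneralLinearGroup.det g = d ∧
      ∀ v : Fin m → ZMod p, v i₁ = 0 → g • v = v)
    (x : GLm p m) {H₁ H₂ H₃ : Subgroup (GLm p m)}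
    (hdes : ∃ c : Mat p m → ℂ, (∀ M, 1 < M.rank → c M = 0) ∧
      (∑ M, c M * ZMod.stdAddChar (Matrix.trace (M * ((1 : GLm p m) : Mat p m)))) = 1 ∧
      ∀ a ∈ H₁, ∀ b ∈ H₂, ∀ g ∈ H₃, a * b * g ≠ 1 →
        (∑ M, c M * ZMod.stdAddChar (Matrix.trace (M * ((a * b * g : GLm p m) : Mat p m)))) = 0) :
    ¬K.map (MulAut.conj x).toMonoidHom ≤ H₁ ∧ ¬K.map (MulAut.conj x).toMonoidHom ≤ H₂ ∧
      ¬K.map (MulAut.conj x).toMonoidHom ≤ H₃ := by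
  -- every vector is fixed by an element of `x K x⁻¹` of determinant `d`: transport the cover
  have hcov : ∀ u : Fin m → ZMod p, ∃ k : K.map (MulAut.conj x).toMonoidHom, k • u = u ∧
      Matrix.GeneralLinearGroup.det (k : GLm p m) = d := by
    intro u
    obtain ⟨k, hk, hdet⟩ := cover_of_pencil hK hK' (x⁻¹ • u)
    refine ⟨⟨x * k * x⁻¹, ⟨k, k.2, rfl⟩⟩, ?_, ?_⟩
    · show (x * (k : GLm p m) * x⁻¹) • u = u
      rw [mul_smul, mul_smul]
      have : (k : GLm p m) • x⁻¹ • u = x⁻¹ • u := hk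
      rw [this, smul_inv_smul]
    · show Matrix.GeneralLinearGroup.det (x * (k : GLm p m) * x⁻¹) = d
      rw [map_mul, map_mul, hdet, map_inv, mul_inv_cancel_comm]
  obtain ⟨f, hf, h1, h0⟩ := exists_test hdes
  exact ⟨fun h => false_of_det_cover_of_ne_one hd hcov hf h1 (vanish_of_le h0 (Or.inl h)),
    fun h => false_of_det_cover_of_ne_one hd hcov hf h1 (vanish_of_le h0 (Or.inr (Or.inl h))),
    fun h => false_of_det_cover_of_ne_one hd hcov hf h1 (vanish_of_le h0 (Or.inr (Or.inr h)))⟩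

end Pencil

end HomologyPencil
end Summit.MatrixMultiplication.MatrixMultiplication.Theorems.SubgroupIdentityDesigns.Negative

end
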